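import Literature.NumberTheory.Rogawski1990.UnitOrbitalIntegralInertCountJZero
import HarnessLib

/-!
# Flicker's PROPOSITION 13 at the torus literal `t(a,b,c)` (`j = 0`, regime `m ≤ N`): `#{y ∈ P_H ⧸ (P_H ∩ H^K_m) : y⁻¹ t y ∈ H^K_m} = iThirteen q N N₊ M m`
(Flicker (1998), *Elementary proof of the fundamental lemma for a unitary group*, Prop. 13 pp. 91–93; Prop. 8 p. 84)

Topic `NumberTheory/Rogawski1990` (road «D-N7-inert», MAP v3 (F8) PROP. 13 → (F7) adapter); namespace `Literature.NumberTheory.Automorphic.UnitaryGroup`.  THEOREMS ONLY; kernel lane.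
Pen F0P3b-p01 (g6) (A-p03 (g24) «=» 05:32:29Z).  The `j = 0` twin of ★ A-p03 `natCard_cosets_flickerTorus_eq_iTen`: no radial conjugation (`i = 0`, `θ̄ = 0`, `r = 1`), the
torus element `t = !![e(a+c), 0, −e(a−c); 0, b, 0; −e(a−c), 0, e(a+c)]` (`2e = 1`, `σz·z = 1` for `z = a, b, c`) read by ★ `natCard_cosets_eq_iThirteen_of_package` with
`A = e(a+c)`, `B = −e(a−c)`: `|B| = |a − c| = |ϖ^N|`, `|A − b| = |a + c − 2b| = |ϖ^{N₊}|`, `(A − b)∕B = −r`, `r = (a+c−2b)∕(a−c)`.  FLICKER'S REGIME DATA from the three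
orders `N = ord(a−c)`, `N₁ = ord(a−b)`, `N₂ = ord(c−b)` (the two smallest coincide): type A `N₊ < N` (then `N₁ = N₂ = N₊`), type B `N ≤ N₊`, `{N₁,N₂} = {N, M}` — entered as
`N₊ < N ∨ (N ≤ N₊ ∧ N ≤ M ∧ N₁ + N₂ = N + M)`; in type B the split `−r = f + g` into `σ`-fixed and anti-fixed parts has `|g| = |σr − r| = |a−b||c−b|∕|a−c| = |ϖ^M|`
(★ `map_ratio_sub_ratio`) and `|f² − 1| = |r² − 1| = |4(a−b)(c−b)∕(a−c)²| = |ϖ^{M−N}|` (for `N ≥ 1`; `m = 0` is the separate lemma `natCard_cosets_eq_one_of_corner`).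
HONEST LABEL: HC_CM is proved only modulo the 2 remaining named inputs (hLiu418, h413) until rung 0 closes; this file is an adapter.

## References
* [Flicker1998UnitaryFL] Y. Z. Flicker, *Elementary proof of the fundamental lemma for a unitary group*, Canad. J. Math. 50 (1998), 74–98: Prop. 13 pp. 91–93, Prop. 8 p. 84.
* [Rogawski1990] J. D. Rogawski, *Automorphic Representations of Unitary Groups in Three Variables* (1990), §4.9 p. 55.
-/

set_option autoImplicit false

open scoped MatrixGroups WithZero Valued
open Matrix

namespace Literature.NumberTheory.Automorphic

namespace UnitaryGroup

open Literature.NumberTheory.Automorphic.HermitianLattice (unitaryInt mem_unitaryInt_iff LocalConjDatum)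
open Literature.NumberTheory.Rogawski1990.Flicker1998 (iThirteen)
open IsLocalRing

variable {K : Type*} [Field K] [Valued K ℤᵐ⁰] {ϖ : K} (σ : K →+* K) {J : Matrix (Fin 3) (Fin 3) K}

/-! ## §1 The level-zero count and the algebra of `r = (a+c−2b)∕(a−c)` -/

omit [Valued K ℤᵐ⁰] in
/-- `r² − 1 = 4(a−b)(c−b)∕(a−c)²` for `r = (a+c−2b)∕(a−c)`. [cite: Flicker1998UnitaryFL, Prop. 13 p. 91] -/
theorem ratio_sq_sub_one {a b c : K} (hac : a - c ≠ 0) :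
    ((a + c - 2 * b) / (a - c)) ^ 2 - 1 = 4 * (a - b) * (c - b) / (a - c) ^ 2 := by
  field_simp
  ring

section Count

variable [IsDiscreteValuationRing 𝒪[K]] [Finite (ResidueField 𝒪[K])] [IsAdicComplete (maximalIdeal 𝒪[K]) 𝒪[K]]

omit [IsAdicComplete (maximalIdeal 𝒪[K]) 𝒪[K]] in
/-- **Level `m = 0`: exactly one coset** for a corner element `τ₀ = !![A,0,B;0,b,0;B,0,A] ∈ U^H` with `|A − b| ≤ 1`, `|B| ≤ 1` — the conditions (2)(3)(4) at `t = 1` hold for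
every `p ∈ P_H` ((R-a) `conditions_of_le_sq`), and `[P_H : P_H ∩ H^K_0] = 1` (★ `index_flickerHK_subgroupOf_flickerPH_eq_one`). [cite: Flicker1998UnitaryFL, Prop. 13 p. 91; Prop. 8 p. 84] -/
theorem natCard_cosets_eq_one_of_corner (hJ : J = (StdForm.antidiagonal 3).over K) (hd : LocalConjDatum σ ϖ)
    (hσO : ∀ y : 𝒪[K], (σ.comp 𝒪[K].subtype) y ∈ 𝒪[K]) {y : K} (hy : y * σ y = -2)
    {c um τ : ↥(unitaryGroupOfForm σ J)} (hc : ((c : GL (Fin 3) K) : Matrix (Fin 3) (Fin 3) K) = !![1, 0, 0; 0, -1, 0; 0, 0, 1])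
    (hum : ((um : GL (Fin 3) K) : Matrix (Fin 3) (Fin 3) K) = !![ϖ ^ 0, y, (ϖ ^ 0)⁻¹; 0, 1, -σ y * (ϖ ^ 0)⁻¹; 0, 0, (ϖ ^ 0)⁻¹])
    {A B b : K} (hτ : ((τ : GL (Fin 3) K) : Matrix (Fin 3) (Fin 3) K) = !![A, 0, B; 0, b, 0; B, 0, A])
    (hτH : τ ∈ Subgroup.centralizer ({c} : Set ↥(unitaryGroupOfForm σ J))) (hB1 : Valued.v B ≤ 1) (hs1 : Valued.v (A - b) ≤ 1)
    {q : ℕ} (hq : Nat.card (ResidueField 𝒪[K]) = q ^ 2)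
    {a₀ : 𝒪[K]} (ha₀ : IsUnit (((σ.comp 𝒪[K].subtype).codRestrict 𝒪[K] hσO) a₀ - a₀)) :
    (Nat.card {w : ↥(flickerPH σ J c) ⧸ (flickerHK σ J c um).subgroupOf (flickerPH σ J c) //
      ((Quotient.out w : ↥(flickerPH σ J c)) : ↥(unitaryGroupOfForm σ J))⁻¹ * τ * (Quotient.out w : ↥(flickerPH σ J c)) ∈ flickerHK σ J c um} : ℚ) = 1 := by
  have h2 : (2 : K) ≠ 0 := fun h => by have := hd.v2; rw [h, map_zero] at this; exact zero_ne_one this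
  have hτ0 : ((τ : GL (Fin 3) K) : Matrix (Fin 3) (Fin 3) K) = !![A, 0, B * ϖ ^ (2 * 0); 0, b, 0; B, 0, A] := by
    rw [hτ, mul_zero, pow_zero, mul_one]
  have h11 : Valued.v (ϖ ^ 0) * Valued.v (ϖ ^ 0) = 1 := by rw [pow_zero, map_one, mul_one]
  rw [natCard_cosets_eq_index_of_forall σ fun p hp => ?_, index_flickerHK_subgroupOf_flickerPH_eq_one σ hJ hd hy hσO hum hc hq ha₀, Nat.cast_one]
  obtain ⟨u, x, w, hpm, hvu, hvx, -, hvw, -⟩ := exists_coe_eq_borel_of_mem_flickerPH σ hJ hd hc hp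
  have hu0 : u ≠ 0 := fun h => by rw [h, map_zero] at hvu; exact zero_ne_one hvu
  have hσu0 : σ u ≠ 0 := fun h => hu0 (by rw [← hd.σσ u, h, map_zero])
  have hw0 : w ≠ 0 := fun h => by rw [h, map_zero] at hvw; exact zero_ne_one hvw
  have hn : Valued.v (u * σ u) = 1 := by rw [map_mul, hd.vσ, hvu, mul_one]
  have hpH : p ∈ Subgroup.centralizer ({c} : Set ↥(unitaryGroupOfForm σ J)) := ((mem_flickerPH_iff h2 hc).1 hp).1.1
  rw [borel_conj_mem_flickerHK_iff σ hJ hd hy 0 hu0 hσu0 hw0 hum hpm hτ0 hpH hτH, show B * ϖ ^ (2 * 0) = B by rw [mul_zero, pow_zero, mul_one]]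
  have h1 : Valued.v ((u * σ u) * B) ≤ 1 := by rw [map_mul, hn, one_mul]; exact hB1
  exact ⟨h1, conditions_of_le_sq σ hd hn hvx (by rw [h11]; exact hs1) (by rw [h11]; exact hB1)⟩

/-- **FLICKER'S PROPOSITION 13 AT THE TORUS LITERAL (`j = 0`, `m ≤ N`)**: for `t = !![e(a+c), 0, −e(a−c); 0, b, 0; −e(a−c), 0, e(a+c)] ∈ U^H` (`2e = 1`, `σz·z = 1`),
`N = ord(a − c)`, `N₊ = ord(a + c − 2b)`, `N₁ = ord(a − b)`, `N₂ = ord(c − b)` and the type datum `N₊ < N ∨ (N ≤ N₊ ∧ N ≤ M ∧ N₁ + N₂ = N + M)`: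
`(#{y ∈ P_H ⧸ (P_H ∩ H^K_m) : y⁻¹ t y ∈ H^K_m} : ℚ) = iThirteen q N N₊ M m` for every `m ≤ N`.  In type B the `σ`-fixed ∕ anti-fixed split of `(A−b)∕B = −r` is fed to
★ `natCard_cosets_eq_iThirteen_of_package` with `|g| = |ϖ^M|` (★ `map_ratio_sub_ratio`) and `|f²−1| = |r²−1| = |ϖ^{M−N}|` (`ratio_sq_sub_one`, ultrametric, `N ≥ 1`); in type A with the
trivial split `f = 0`; `m = 0` by `natCard_cosets_eq_one_of_corner`. [cite: Flicker1998UnitaryFL, Prop. 13 pp. 91–93; Prop. 8 p. 84] -/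
theorem natCard_cosets_flickerTorusOne_eq_iThirteen (hJ : J = (StdForm.antidiagonal 3).over K) (hd : LocalConjDatum σ ϖ)
    (hσO : ∀ y : 𝒪[K], (σ.comp 𝒪[K].subtype) y ∈ 𝒪[K]) {y : K} (hy : y * σ y = -2)
    {c um t : ↥(unitaryGroupOfForm σ J)} (hc : ((c : GL (Fin 3) K) : Matrix (Fin 3) (Fin 3) K) = !![1, 0, 0; 0, -1, 0; 0, 0, 1])
    {m : ℕ} (hum : ((um : GL (Fin 3) K) : Matrix (Fin 3) (Fin 3) K) = !![ϖ ^ m, y, (ϖ ^ m)⁻¹; 0, 1, -σ y * (ϖ ^ m)⁻¹; 0, 0, (ϖ ^ m)⁻¹])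
    {e a b cc : K} (h2e : 2 * e = 1) (ha : σ a * a = 1) (hb : σ b * b = 1) (hcc : σ cc * cc = 1)
    (hte : ((t : GL (Fin 3) K) : Matrix (Fin 3) (Fin 3) K) = !![e * (a + cc), 0, -(e * (a - cc)); 0, b, 0; -(e * (a - cc)), 0, e * (a + cc)])
    (htH : t ∈ Subgroup.centralizer ({c} : Set ↥(unitaryGroupOfForm σ J)))
    {N Np N₁ N₂ M : ℕ} (hmN : m ≤ N) (hN : Valued.v (a - cc) = Valued.v (ϖ ^ N)) (hNp : Valued.v (a + cc - 2 * b) = Valued.v (ϖ ^ Np))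
    (hN₁ : Valued.v (a - b) = Valued.v (ϖ ^ N₁)) (hN₂ : Valued.v (cc - b) = Valued.v (ϖ ^ N₂))
    (hreg : Np < N ∨ (N ≤ Np ∧ N ≤ M ∧ N₁ + N₂ = N + M))
    {q : ℕ} (hq : Nat.card (ResidueField 𝒪[K]) = q ^ 2)
    {a₀ : 𝒪[K]} (ha₀ : IsUnit (((σ.comp 𝒪[K].subtype).codRestrict 𝒪[K] hσO) a₀ - a₀)) :
    (Nat.card {w : ↥(flickerPH σ J c) ⧸ (flickerHK σ J c um).subgroupOf (flickerPH σ J c) //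
      ((Quotient.out w : ↥(flickerPH σ J c)) : ↥(unitaryGroupOfForm σ J))⁻¹ * t * (Quotient.out w : ↥(flickerPH σ J c)) ∈ flickerHK σ J c um} : ℚ) =
      iThirteen q N Np M m := by
  have h2v : Valued.v (2 : K) = 1 := hd.v2
  have h2 : (2 : K) ≠ 0 := fun h => by rw [h, map_zero] at h2v; exact zero_ne_one h2v
  have hϖ0 : ϖ ≠ 0 := hd.ϖ_ne_zero
  have he0 : e ≠ 0 := fun h => by rw [h, mul_zero] at h2e; exact zero_ne_one h2e
  have hve : Valued.v e = 1 := by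
    have := congrArg Valued.v h2e; rw [map_mul, h2v, one_mul, map_one] at this; exact this
  have ha0 : a ≠ 0 := fun h => by rw [h, mul_zero] at ha; exact zero_ne_one ha
  have hb0 : b ≠ 0 := fun h => by rw [h, mul_zero] at hb; exact zero_ne_one hb
  have hc0 : cc ≠ 0 := fun h => by rw [h, mul_zero] at hcc; exact zero_ne_one hcc
  have hvb : Valued.v b = 1 := by
    have h1 := congrArg Valued.v hb; rw [map_mul, hd.vσ, map_one] at h1
    exact Literature.NumberTheory.QuadraticForms.OMeara65.WithZeroMulInt.eq_one_of_mul_self h1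
  have hac : a ≠ cc := by
    intro h; rw [h, sub_self, map_zero] at hN; exact (pow_ne_zero _ hϖ0) ((map_eq_zero _).1 hN.symm)
  have hac' : a - cc ≠ 0 := sub_ne_zero.2 hac
  -- the corner data `A = e(a+c)`, `B = −e(a−c)`
  have hvB : Valued.v (-(e * (a - cc))) = Valued.v (ϖ ^ N) := by rw [Valuation.map_neg, map_mul, hve, one_mul, hN]
  have hAb : e * (a + cc) - b = e * (a + cc - 2 * b) := by linear_combination b * h2e
  have hs : Valued.v (e * (a + cc) - b) = Valued.v (ϖ ^ Np) := by rw [hAb, map_mul, hve, one_mul, hNp]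
  have hdr : (e * (a + cc) - b) / (-(e * (a - cc))) = -((a + cc - 2 * b) / (a - cc)) := by
    rw [hAb]; field_simp
  rcases Nat.eq_zero_or_pos m with hm0 | hm
  · -- m = 0
    subst hm0
    rw [natCard_cosets_eq_one_of_corner σ hJ hd hσO hy hc hum hte htH (by rw [hvB]; exact hd.v_pow_le_one N)
      (by rw [hs]; exact hd.v_pow_le_one Np) hq ha₀, iThirteen, if_pos rfl]
  rcases hreg with hA | ⟨hNNp, hNM, hsum⟩
  · -- type A: the trivial split `f = 0`
    exact natCard_cosets_eq_iThirteen_of_package σ hJ hd hσO hy hmN hc hum hte htH hvB hs (f := 0) (g := (e * (a + cc) - b) / (-(e * (a - cc))))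
      (by rw [zero_add]) (map_zero σ) (by rw [map_zero]; exact zero_le_one) (Or.inl hA) hq ha₀
  · -- type B: the genuine split `−r = f + g`, `f = −(r + σr)∕2`, `g = (σr − r)∕2`
    have hN1 : 1 ≤ N := le_trans hm hmN
    have hσa : σ a = a⁻¹ := eq_inv_of_mul_eq_one_left ha
    have hσb : σ b = b⁻¹ := eq_inv_of_mul_eq_one_left hb
    have hσc : σ cc = cc⁻¹ := eq_inv_of_mul_eq_one_left hcc
    set r : K := (a + cc - 2 * b) / (a - cc) with hr
    have hσrr : σ r - r = 2 * (a - b) * (cc - b) / (b * (a - cc)) := map_ratio_sub_ratio σ hσa hσb hσc ha0 hb0 hc0 hac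
    set f : K := -(e * (r + σ r)) with hf
    set g : K := e * (σ r - r) with hg
    have hfg : (e * (a + cc) - b) / (-(e * (a - cc))) = f + g := by
      rw [hdr, hf, hg]; linear_combination (r : K) * h2e
    have he2 : e = (2 : K)⁻¹ := by rw [← one_div, eq_div_iff h2, mul_comm]; exact h2e
    have hσe : σ e = e := by rw [he2, map_inv₀, map_ofNat]
    have hσf : σ f = f := by rw [hf, map_neg, map_mul, map_add, hd.σσ, hσe, add_comm]
    -- valuations
    have hvr : Valued.v r ≤ 1 := by
      rw [hr, map_div₀, hNp, hN, hd.v_pow, hd.v_pow, ← WithZero.exp_sub, ← WithZero.exp_zero, WithZero.exp_le_exp]; omega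
    have hvσr : Valued.v (σ r) ≤ 1 := by rw [hd.vσ]; exact hvr
    have hvg : Valued.v g = Valued.v (ϖ ^ M) := by
      rw [hg, map_mul, hve, one_mul, hσrr, map_div₀, map_mul, map_mul, map_mul, h2v, one_mul, hvb, one_mul, hN₁, hN₂, hN,
        hd.v_pow, hd.v_pow, hd.v_pow, hd.v_pow, ← WithZero.exp_add, ← WithZero.exp_sub, WithZero.exp_inj]
      omega
    have hf1 : Valued.v f ≤ 1 := by
      rw [hf, Valuation.map_neg, map_mul, hve, one_mul]
      exact le_trans (Valuation.map_add _ _ _) (max_le hvr hvσr)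
    -- `|f² − 1| = |r² − 1| = |ϖ^{M−N}|`
    have hr2 : Valued.v (r ^ 2 - 1) = Valued.v (ϖ ^ (M - N)) := by
      rw [hr, ratio_sq_sub_one hac', map_div₀, map_mul, map_mul, map_pow, show (4 : K) = 2 * 2 by norm_num, map_mul, h2v, one_mul, one_mul,
        hN₁, hN₂, hN, hd.v_pow, hd.v_pow, hd.v_pow, hd.v_pow, ← WithZero.exp_add, ← WithZero.exp_nsmul, ← WithZero.exp_sub, WithZero.exp_inj]
      simp only [nsmul_eq_mul, Nat.cast_ofNat]; omega
    have hfr : f = -r + (-g) := by rw [hf, hg]; linear_combination (-(r : K)) * h2e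
    have hf2 : f ^ 2 - 1 = (r ^ 2 - 1) + g * (2 * r + g) := by rw [hfr]; ring
    have hsmall : Valued.v (g * (2 * r + g)) < Valued.v (r ^ 2 - 1) := by
      rw [hr2, map_mul, hvg]
      have h2r : Valued.v (2 * r + g) ≤ 1 := le_trans (Valuation.map_add _ _ _)
        (max_le (by rw [map_mul, h2v, one_mul]; exact hvr) (by rw [hvg]; exact hd.v_pow_le_one M))
      calc Valued.v (ϖ ^ M) * Valued.v (2 * r + g) ≤ Valued.v (ϖ ^ M) * 1 := mul_le_mul' (le_refl _) h2r
        _ < Valued.v (ϖ ^ (M - N)) := by rw [mul_one, hd.v_pow, hd.v_pow, WithZero.exp_lt_exp]; omega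
    have hc₁ : Valued.v (f ^ 2 - 1) = Valued.v (ϖ ^ (M - N)) := by
      rw [hf2, Valuation.map_add_eq_of_lt_left _ hsmall, hr2]
    exact natCard_cosets_eq_iThirteen_of_package σ hJ hd hσO hy hmN hc hum hte htH hvB hs hfg hσf hf1
      (Or.inr ⟨hNNp, hNM, hc₁, hvg⟩) hq ha₀

end Count

end UnitaryGroup

end Literature.NumberTheory.Automorphic
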